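import Mathlib
import Summits.Ventures.HodgeRepro.Tier4.Line4.InnerSplit
import Summits.Ventures.HodgeRepro.Tier4.Line4.LevelIndicator
import Summits.Ventures.HodgeRepro.Tier4.Line4.PlaceIdem
import Summits.Ventures.HodgeRepro.Tier4.Line4.PlacePart
import Summits.Ventures.HodgeRepro.Tier4.Line4.TorusFinSplit
import Summits.Ventures.HodgeRepro.Tier4.Line4.TorusFinSplitHaar
import Summits.Ventures.HodgeRepro.Tier4.Line4.LevelSplit

/-!
# Tier4/Line4/MainTermSplit — C-L4-LEVELONE-LOCAL (a): the main-term finite integral FACTORS along the `S`-split, and the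
away-from-`p` factor is level-one (`n`-free)

Blind re-derivation cell `pub-hodge-repro`, Tier 4 «prove the step» (README §9–§10), LINE L4, seat t4-x2 (g5, reserve
wall-breaker; L2-p1 g3's brief proofs/t4-L2-p1/LINE-t4-L4-x2-LEVELONE-LOCAL.md on lead S15587 / plan-4 S15510 (3);
statement S15695).  Tree path `lean/Summits/Ventures/HodgeRepro/Tier4/Line4/MainTermSplit.lean`.  Imports L4-p2's InnerSplit
(`innerFin`), L2-p1's LevelIndicator (`levelDC`) and PSPLIT modules (`ofPlacesPart`/`offPlacesPart`, `torusFinAt`/`torusFinAway`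
and the `T′` twins, `torusFinSplit` with `integral_eq_smul_integral_prod_fin`, `levelDCAt`/`levelDCAway` with `levelDC_eq_mul`,
`levelDCAway_pow_eq`).  Mathlib-level; no literature.

WHAT.  The finite main-term integral of the witness of record, `∫_{DZ_f} χ(b) · I_f(b) dν_f` with
`I_f(b) = ∫_{T′_f} conj χ′(b′) · 1[b⁻¹ γ₀,f b′ ∈ K(p^n) γ₀,f K(p^n)] dν′_f` (the `levelDC` indicator), is — along the split
`T_f = T_S × T_f^{(S)}`, `S` the places above `p`, with Haar measures `ν_f = c (ν_S ⊗ ν^{(S)})`, `ν′_f = c′ (ν′_S ⊗ ν′^{(S)})`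
and a product domain `DZ_f = DZ_S × DZ^{(S)}` — the product `c c′ · I_S(n) · c₀(γ₀)` of a LOCAL factor at `S` at level `p^n`
(`localFactorAt`) and an AWAY-FROM-`S` orbital integral at LEVEL ONE (`awayOrbital`, `n`-free by `levelDCAway_pow_eq`).
The two integrability clauses of the theorem are the chain's `hIfin` / `hB` (HorbMain / `ChainInputs`), DISPLAYED hypotheses
of a lemma.  The display `awayOrbital ≠ 0` (`c₀(γ₀) ≠ 0`: the line's «non-vanishing at `γ₀`» clause, brief §2, plan-4
S15484/S15510) is NAMED here and NOT proved.

* `chi_coe_mul` / `chi'_coe_mul` — the characters split along `T_S × T_f^{(S)}`.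
* `ofPlacesPart_conjArg` / `offPlacesPart_conjArg` — the `S`-part / away part of `(x y)⁻¹ γ₀,f (x′ y′)` is `x⁻¹ γ₀,S x′` /
  `y⁻¹ γ₀^{(S)} y′`; hence `levelDCAt_conjArg` / `levelDCAway_conjArg`.
* `innerFin_levelDC_coe_mul` — the inner integral at `x y` factors as `c′ · A_S(x) · B^{(S)}(y)`.
* **`setIntegral_chi_innerFin_levelDC_eq_mul`** — the factorisation of record at `S = placesAbove p`, `N = p^n`, over the
  PRODUCT-SHAPED domain `torusFinSplit⁻¹(DZ_S × DZ^{(S)})`.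
* The `Z(k)`-invariance of the integrand and the factorisation at the GLUE'S `DZ_f` (way (β), S15703) are in the companion
  module `Line4/MainTermSplitInvariance` (the ≤ 400-line rule).

Nothing here says anything about the status of the Hodge conjecture for CM abelian varieties, which is NOT proved
(HC_CM is NOT proved by anyone in this repository).
-/

set_option autoImplicit false

noncomputable section

namespace Summit.Ventures.HodgeRepro.Tier4.Line4

open MeasureTheory NumberField IsDedekindDomain Summit.Ventures.HodgeRepro.Tier4
  Summit.Ventures.HodgeRepro.Tier4.Common Summit.Ventures.HodgeRepro.Tier4.Line1

open scoped NumberField ComplexConjugate NNReal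

section Defs

variable {k : Type} [Field k] [NumberField k] (W : PlaneData k) (S : Set (HeightOneSpectrum (𝓞 k)))
  [MeasurableSpace (GA W)] (R : RTFData W) (γ₀ : GA W)

/-- **The local factor at `S`, level `N`**: `I_S(N) = ∫_{DZ_S} χ(x) ∫_{T′_S} conj χ′(x′) · 1[x⁻¹ γ₀,f x′ ∈ K(N) γ₀ K(N)]_S dν′_S dν_S`. -/
def localFactorAt (N : ℕ) (νS : Measure (torusFinAt W S)) (νS' : Measure (torusFinAt' W S))
    (DZS : Set (torusFinAt W S)) : ℂ :=
  ∫ x in DZS, R.chi ((x : torusFin W) : torusT W) *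
    ∫ x', conj (R.chi' ((x' : torusFin' W) : torusT' W)) *
      levelDCAt W S γ₀ N ((((x : torusFin W) : torusT W) : GA W)⁻¹ * GA.ofFinPart W γ₀ *
        (((x' : torusFin' W) : torusT' W) : GA W)) ∂νS' ∂νS

/-- **The away-from-`S` orbital integral at LEVEL ONE**: `c₀(γ₀) = ∫_{DZ^{(S)}} χ(y) ∫_{T′^{(S)}} conj χ′(y′) ·
1[y⁻¹ γ₀,f y′ ∈ K(1) γ₀ K(1)]^{(S)} dν′^{(S)} dν^{(S)}` — `n`-free (`levelDCAway_pow_eq`).  DISPLAY (not proved here):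
`awayOrbital ≠ 0`, the line's «non-vanishing at `γ₀`» clause away from `p`. -/
def awayOrbital (νA : Measure (torusFinAway W S)) (νA' : Measure (torusFinAway' W S))
    (DZA : Set (torusFinAway W S)) : ℂ :=
  ∫ y in DZA, R.chi ((y : torusFin W) : torusT W) *
    ∫ y', conj (R.chi' ((y' : torusFin' W) : torusT' W)) *
      levelDCAway W S γ₀ 1 ((((y : torusFin W) : torusT W) : GA W)⁻¹ * GA.ofFinPart W γ₀ *
        (((y' : torusFin' W) : torusT' W) : GA W)) ∂νA' ∂νA

end Defs

section Chars

variable {k : Type} [Field k] [NumberField k] (W : PlaneData k) (S : Set (HeightOneSpectrum (𝓞 k)))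
  [MeasurableSpace (GA W)]

/-- The character `χ` splits along `T_S × T_f^{(S)}`. -/
theorem chi_coe_mul (R : RTFData W) (x : torusFinAt W S) (y : torusFinAway W S) :
    R.chi ((((x : torusFin W) * (y : torusFin W) : torusFin W) : torusT W)) =
      R.chi ((x : torusFin W) : torusT W) * R.chi ((y : torusFin W) : torusT W) := by
  rw [Subgroup.coe_mul, R.chi_mul]

/-- The character `χ′` splits along `T′_S × T′^{(S)}`. -/
theorem chi'_coe_mul (R : RTFData W) (x' : torusFinAt' W S) (y' : torusFinAway' W S) :
    R.chi' ((((x' : torusFin' W) * (y' : torusFin' W) : torusFin' W) : torusT' W)) =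
      R.chi' ((x' : torusFin' W) : torusT' W) * R.chi' ((y' : torusFin' W) : torusT' W) := by
  rw [Subgroup.coe_mul, R.chi'_mul]

end Chars

section Split

variable {k : Type} [Field k] [NumberField k] (W : PlaneData k) (S : Set (HeightOneSpectrum (𝓞 k)))

/-- Elements of `T_S` are supported on `S`. -/
theorem coe_torusFinAt_mem_supportedOn (x : torusFinAt W S) :
    (((x : torusFin W) : torusT W) : GA W) ∈ supportedOn W S := (mem_torusFinAt W S _).1 x.2

/-- Elements of `T_f^{(S)}` are trivial on `S`. -/
theorem coe_torusFinAway_mem_trivialOn (y : torusFinAway W S) :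
    (((y : torusFin W) : torusT W) : GA W) ∈ trivialOn W S := (mem_torusFinAway W S _).1 y.2

/-- Elements of `T′_S` are supported on `S`. -/
theorem coe_torusFinAt'_mem_supportedOn (x' : torusFinAt' W S) :
    (((x' : torusFin' W) : torusT' W) : GA W) ∈ supportedOn W S := (mem_torusFinAt' W S _).1 x'.2

/-- Elements of `T′^{(S)}` are trivial on `S`. -/
theorem coe_torusFinAway'_mem_trivialOn (y' : torusFinAway' W S) :
    (((y' : torusFin' W) : torusT' W) : GA W) ∈ trivialOn W S := (mem_torusFinAway' W S _).1 y'.2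

/-- A finite torus element lies in `G(𝔸_f)`. -/
theorem coe_torusFin_mem_finitePart (b : torusFin W) : ((b : torusT W) : GA W) ∈ finitePart W := b.2

/-- A finite `T′`-element lies in `G(𝔸_f)`. -/
theorem coe_torusFin'_mem_finitePart (b : torusFin' W) : ((b : torusT' W) : GA W) ∈ finitePart W := b.2

variable (γ₀ : GA W)

/-- **The `S`-part of `(x y)⁻¹ γ₀,f (x′ y′)` is `x⁻¹ γ₀,S x′`** (the away factors have trivial `S`-part). -/
theorem ofPlacesPart_conjArg (x : torusFinAt W S) (y : torusFinAway W S) (x' : torusFinAt' W S)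
    (y' : torusFinAway' W S) :
    GA.ofPlacesPart W S (GA.ofFinPart W
      (((((x : torusFin W) * (y : torusFin W) : torusFin W) : torusT W) : GA W)⁻¹ * GA.ofFinPart W γ₀ *
        ((((x' : torusFin' W) * (y' : torusFin' W) : torusFin' W) : torusT' W) : GA W))) =
      (((x : torusFin W) : torusT W) : GA W)⁻¹ * GA.ofPlacesPart W S (GA.ofFinPart W γ₀) *
        (((x' : torusFin' W) : torusT' W) : GA W) := by
  rw [Subgroup.coe_mul, Subgroup.coe_mul, Subgroup.coe_mul, Subgroup.coe_mul]
  have hfin : (((x : torusFin W) : torusT W) : GA W) * (((y : torusFin W) : torusT W) : GA W) ∈ finitePart W :=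
    Subgroup.mul_mem _ (coe_torusFin_mem_finitePart W _) (coe_torusFin_mem_finitePart W _)
  have hfin' : (((x' : torusFin' W) : torusT' W) : GA W) * (((y' : torusFin' W) : torusT' W) : GA W) ∈
      finitePart W :=
    Subgroup.mul_mem _ (coe_torusFin'_mem_finitePart W _) (coe_torusFin'_mem_finitePart W _)
  rw [ofFinPart_eq_self_of_mem_finitePart W (Subgroup.mul_mem _ (Subgroup.mul_mem _ (Subgroup.inv_mem _ hfin)
    (ofFinPart_mem_finitePart W γ₀)) hfin'), ofPlacesPart_mul, ofPlacesPart_mul, ofPlacesPart_inv, ofPlacesPart_mul,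
    ofPlacesPart_mul, ofPlacesPart_eq_self_of_mem_supportedOn W S (coe_torusFinAt_mem_supportedOn W S x),
    ofPlacesPart_eq_one_of_mem_trivialOn W S (coe_torusFinAway_mem_trivialOn W S y),
    ofPlacesPart_eq_self_of_mem_supportedOn W S (coe_torusFinAt'_mem_supportedOn W S x'),
    ofPlacesPart_eq_one_of_mem_trivialOn W S (coe_torusFinAway'_mem_trivialOn W S y'), mul_one, mul_one]

/-- **The away part of `(x y)⁻¹ γ₀,f (x′ y′)` is `y⁻¹ γ₀^{(S)} y′`**. -/
theorem offPlacesPart_conjArg (x : torusFinAt W S) (y : torusFinAway W S) (x' : torusFinAt' W S)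
    (y' : torusFinAway' W S) :
    GA.offPlacesPart W S (GA.ofFinPart W
      (((((x : torusFin W) * (y : torusFin W) : torusFin W) : torusT W) : GA W)⁻¹ * GA.ofFinPart W γ₀ *
        ((((x' : torusFin' W) * (y' : torusFin' W) : torusFin' W) : torusT' W) : GA W))) =
      (((y : torusFin W) : torusT W) : GA W)⁻¹ * GA.offPlacesPart W S (GA.ofFinPart W γ₀) *
        (((y' : torusFin' W) : torusT' W) : GA W) := by
  rw [Subgroup.coe_mul, Subgroup.coe_mul, Subgroup.coe_mul, Subgroup.coe_mul]
  have hfin : (((x : torusFin W) : torusT W) : GA W) * (((y : torusFin W) : torusT W) : GA W) ∈ finitePart W :=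
    Subgroup.mul_mem _ (coe_torusFin_mem_finitePart W _) (coe_torusFin_mem_finitePart W _)
  have hfin' : (((x' : torusFin' W) : torusT' W) : GA W) * (((y' : torusFin' W) : torusT' W) : GA W) ∈
      finitePart W :=
    Subgroup.mul_mem _ (coe_torusFin'_mem_finitePart W _) (coe_torusFin'_mem_finitePart W _)
  rw [ofFinPart_eq_self_of_mem_finitePart W (Subgroup.mul_mem _ (Subgroup.mul_mem _ (Subgroup.inv_mem _ hfin)
    (ofFinPart_mem_finitePart W γ₀)) hfin'), offPlacesPart_mul, offPlacesPart_mul, offPlacesPart_inv, offPlacesPart_mul,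
    offPlacesPart_mul, offPlacesPart_eq_one_of_mem_supportedOn W S (coe_torusFinAt_mem_supportedOn W S x),
    offPlacesPart_eq_self_of_mem_trivialOn W S (coe_torusFin_mem_finitePart W _) (coe_torusFinAway_mem_trivialOn W S y),
    offPlacesPart_eq_one_of_mem_supportedOn W S (coe_torusFinAt'_mem_supportedOn W S x'),
    offPlacesPart_eq_self_of_mem_trivialOn W S (coe_torusFin'_mem_finitePart W _)
      (coe_torusFinAway'_mem_trivialOn W S y'), one_mul, one_mul]

/-- The `S`-part of the pure argument `x⁻¹ γ₀,f x′` is itself (at the `S`-part of `γ₀,f`). -/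
theorem ofPlacesPart_pureArg (x : torusFinAt W S) (x' : torusFinAt' W S) :
    GA.ofPlacesPart W S (GA.ofFinPart W
      ((((x : torusFin W) : torusT W) : GA W)⁻¹ * GA.ofFinPart W γ₀ * (((x' : torusFin' W) : torusT' W) : GA W))) =
      (((x : torusFin W) : torusT W) : GA W)⁻¹ * GA.ofPlacesPart W S (GA.ofFinPart W γ₀) *
        (((x' : torusFin' W) : torusT' W) : GA W) := by
  rw [ofFinPart_eq_self_of_mem_finitePart W (Subgroup.mul_mem _ (Subgroup.mul_mem _
    (Subgroup.inv_mem _ (coe_torusFin_mem_finitePart W _)) (ofFinPart_mem_finitePart W γ₀))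
    (coe_torusFin'_mem_finitePart W _)), ofPlacesPart_mul, ofPlacesPart_mul, ofPlacesPart_inv,
    ofPlacesPart_eq_self_of_mem_supportedOn W S (coe_torusFinAt_mem_supportedOn W S x),
    ofPlacesPart_eq_self_of_mem_supportedOn W S (coe_torusFinAt'_mem_supportedOn W S x')]

/-- The away part of the pure argument `y⁻¹ γ₀,f y′` is itself (at the away part of `γ₀,f`). -/
theorem offPlacesPart_pureArg (y : torusFinAway W S) (y' : torusFinAway' W S) :
    GA.offPlacesPart W S (GA.ofFinPart W
      ((((y : torusFin W) : torusT W) : GA W)⁻¹ * GA.ofFinPart W γ₀ * (((y' : torusFin' W) : torusT' W) : GA W))) =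
      (((y : torusFin W) : torusT W) : GA W)⁻¹ * GA.offPlacesPart W S (GA.ofFinPart W γ₀) *
        (((y' : torusFin' W) : torusT' W) : GA W) := by
  rw [ofFinPart_eq_self_of_mem_finitePart W (Subgroup.mul_mem _ (Subgroup.mul_mem _
    (Subgroup.inv_mem _ (coe_torusFin_mem_finitePart W _)) (ofFinPart_mem_finitePart W γ₀))
    (coe_torusFin'_mem_finitePart W _)), offPlacesPart_mul, offPlacesPart_mul, offPlacesPart_inv,
    offPlacesPart_eq_self_of_mem_trivialOn W S (coe_torusFin_mem_finitePart W _) (coe_torusFinAway_mem_trivialOn W S y),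
    offPlacesPart_eq_self_of_mem_trivialOn W S (coe_torusFin'_mem_finitePart W _)
      (coe_torusFinAway'_mem_trivialOn W S y')]

/-- **The `S`-factor of the level indicator at the product argument is the `S`-factor at the pure argument.** -/
theorem levelDCAt_conjArg (N : ℕ) (x : torusFinAt W S) (y : torusFinAway W S) (x' : torusFinAt' W S)
    (y' : torusFinAway' W S) :
    levelDCAt W S γ₀ N
      (((((x : torusFin W) * (y : torusFin W) : torusFin W) : torusT W) : GA W)⁻¹ * GA.ofFinPart W γ₀ *
        ((((x' : torusFin' W) * (y' : torusFin' W) : torusFin' W) : torusT' W) : GA W)) =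
      levelDCAt W S γ₀ N
        ((((x : torusFin W) : torusT W) : GA W)⁻¹ * GA.ofFinPart W γ₀ * (((x' : torusFin' W) : torusT' W) : GA W)) := by
  unfold levelDCAt
  rw [ofPlacesPart_conjArg, ofPlacesPart_pureArg]

/-- **The away factor of the level indicator at the product argument is the away factor at the pure argument.** -/
theorem levelDCAway_conjArg (N : ℕ) (x : torusFinAt W S) (y : torusFinAway W S) (x' : torusFinAt' W S)
    (y' : torusFinAway' W S) :
    levelDCAway W S γ₀ N
      (((((x : torusFin W) * (y : torusFin W) : torusFin W) : torusT W) : GA W)⁻¹ * GA.ofFinPart W γ₀ *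
        ((((x' : torusFin' W) * (y' : torusFin' W) : torusFin' W) : torusT' W) : GA W)) =
      levelDCAway W S γ₀ N
        ((((y : torusFin W) : torusT W) : GA W)⁻¹ * GA.ofFinPart W γ₀ * (((y' : torusFin' W) : torusT' W) : GA W)) := by
  unfold levelDCAway
  rw [offPlacesPart_conjArg, offPlacesPart_pureArg]

end Split

section Inner

variable {k : Type} [Field k] [NumberField k] (W : PlaneData k) (S : Set (HeightOneSpectrum (𝓞 k)))
  [MeasurableSpace (GA W)] [BorelSpace (GA W)] (R : RTFData W) (γ₀ : GA W)

/-- **The inner integral at `x y` factors**: `I_f(x y) = c′ · A_S(x) · B^{(S)}(y)` with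
`A_S(x) = ∫ conj χ′(x′) · 1_S(x⁻¹ γ₀ x′) dν′_S`, `B^{(S)}(y) = ∫ conj χ′(y′) · 1^{(S)}(y⁻¹ γ₀ y′) dν′^{(S)}`. -/
theorem innerFin_levelDC_coe_mul (N : ℕ)
    (νf' : Measure (torusFin' W)) [νf'.IsHaarMeasure] (νS' : Measure (torusFinAt' W S)) [νS'.IsHaarMeasure]
    (νA' : Measure (torusFinAway' W S)) [νA'.IsHaarMeasure] (c' : ℝ≥0)
    (hc' : νf' = c' • Measure.map (torusFinSplit' W S).symm (νS'.prod νA'))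
    (hB : ∀ t : torusT W, Integrable (fun b' : torusFin' W => conj (R.chi' (b' : torusT' W)) *
      levelDC W γ₀ N ((GA.ofFinPart W t)⁻¹ * GA.ofFinPart W γ₀ * ((b' : torusT' W) : GA W))) νf')
    (x : torusFinAt W S) (y : torusFinAway W S) :
    innerFin W R (levelDC W γ₀ N) γ₀ νf' ((x : torusFin W) * (y : torusFin W)) =
      (c' : ℂ) *
        (∫ x', conj (R.chi' ((x' : torusFin' W) : torusT' W)) *
          levelDCAt W S γ₀ N ((((x : torusFin W) : torusT W) : GA W)⁻¹ * GA.ofFinPart W γ₀ *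
            (((x' : torusFin' W) : torusT' W) : GA W)) ∂νS') *
        (∫ y', conj (R.chi' ((y' : torusFin' W) : torusT' W)) *
          levelDCAway W S γ₀ N ((((y : torusFin W) : torusT W) : GA W)⁻¹ * GA.ofFinPart W γ₀ *
            (((y' : torusFin' W) : torusT' W) : GA W)) ∂νA') := by
  have hint : Integrable (fun b' : torusFin' W => conj (R.chi' (b' : torusT' W)) *
      levelDC W γ₀ N (((((x : torusFin W) * (y : torusFin W) : torusFin W) : torusT W) : GA W)⁻¹ *
        GA.ofFinPart W γ₀ * ((b' : torusT' W) : GA W))) νf' := by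
    have h := hB ((((x : torusFin W) * (y : torusFin W) : torusFin W) : torusT W))
    rwa [ofFinPart_eq_self_of_mem_finitePart W (coe_torusFin_mem_finitePart W _)] at h
  unfold innerFin
  rw [integral_eq_smul_integral_prod_fin' W S νf' νS' νA' c' hc' _ hint, Complex.real_smul, mul_assoc]
  congr 1
  have hpt : ∀ (x' : torusFinAt' W S) (y' : torusFinAway' W S),
      conj (R.chi' ((((x' : torusFin' W) * (y' : torusFin' W) : torusFin' W) : torusT' W))) *
        levelDC W γ₀ N (((((x : torusFin W) * (y : torusFin W) : torusFin W) : torusT W) : GA W)⁻¹ *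
          GA.ofFinPart W γ₀ * ((((x' : torusFin' W) * (y' : torusFin' W) : torusFin' W) : torusT' W) : GA W)) =
      (conj (R.chi' ((x' : torusFin' W) : torusT' W)) *
        levelDCAt W S γ₀ N ((((x : torusFin W) : torusT W) : GA W)⁻¹ * GA.ofFinPart W γ₀ *
          (((x' : torusFin' W) : torusT' W) : GA W))) *
      (conj (R.chi' ((y' : torusFin' W) : torusT' W)) *
        levelDCAway W S γ₀ N ((((y : torusFin W) : torusT W) : GA W)⁻¹ * GA.ofFinPart W γ₀ *
          (((y' : torusFin' W) : torusT' W) : GA W))) := by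
    intro x' y'
    rw [chi'_coe_mul, map_mul, levelDC_eq_mul W S, levelDCAt_conjArg, levelDCAway_conjArg]
    ring
  rw [← integral_mul_const]
  refine integral_congr_ae (Filter.Eventually.of_forall fun x' => ?_)
  dsimp only
  rw [← integral_const_mul]
  refine integral_congr_ae (Filter.Eventually.of_forall fun y' => ?_)
  dsimp only
  exact hpt x' y'

end Inner

section Main

variable {k : Type} [Field k] [NumberField k] (W : PlaneData k) [MeasurableSpace (GA W)] [BorelSpace (GA W)]
  (R : RTFData W) (γ₀ : GA W)

/-- The product domain `DZ_S × DZ^{(S)}` pulled back to `T_f` is measurable. -/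
theorem measurableSet_preimage_torusFinSplit_prod (S : Set (HeightOneSpectrum (𝓞 k)))
    {DZS : Set (torusFinAt W S)} (hDZS : MeasurableSet DZS) {DZA : Set (torusFinAway W S)} (hDZA : MeasurableSet DZA) :
    MeasurableSet ((torusFinSplit W S) ⁻¹' (DZS ×ˢ DZA)) := by
  haveI := secondCountable_GA W
  haveI : BorelSpace (torusT W) := Subtype.borelSpace _
  haveI : BorelSpace (torusFin W) := Subtype.borelSpace _
  haveI : BorelSpace (torusFinAt W S) := Subtype.borelSpace _
  haveI : BorelSpace (torusFinAway W S) := Subtype.borelSpace _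
  haveI : SecondCountableTopology (torusFin W) := secondCountable_torusFin W
  haveI : SecondCountableTopology (torusFinAt W S) := secondCountable_torusFinAt W S
  haveI : SecondCountableTopology (torusFinAway W S) := secondCountable_torusFinAway W S
  haveI : BorelSpace (torusFinAt W S × torusFinAway W S) := Prod.borelSpace
  exact (hDZS.prod hDZA).preimage (torusFinSplit W S).continuous.measurable

/-- **C-L4-LEVELONE-LOCAL (a) — THE MAIN-TERM FINITE INTEGRAL FACTORS ALONG THE `p`-SPLIT**: with `S` the places above
`p`, the Haar normalisations `ν_f = c (ν_S ⊗ ν^{(S)})`, `ν′_f = c′ (ν′_S ⊗ ν′^{(S)})`, the product domain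
`DZ_f = torusFinSplit⁻¹(DZ_S × DZ^{(S)})` and the chain's two integrability clauses (`hint` = `hIfin`, `hB` = `hB` of
`ChainInputs` at `F_f := levelDC (p^n)`):
`∫_{DZ_f} χ(b) I_f(b) dν_f = c c′ · I_S(n) · c₀(γ₀)`, the away factor at LEVEL ONE (`levelDCAway_pow_eq`). -/
theorem setIntegral_chi_innerFin_levelDC_eq_mul (p n : ℕ)
    (νf : Measure (torusFin W)) [νf.IsHaarMeasure]
    (νS : Measure (torusFinAt W (placesAbove (k := k) p))) [νS.IsHaarMeasure]
    (νA : Measure (torusFinAway W (placesAbove (k := k) p))) [νA.IsHaarMeasure]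
    (c : ℝ≥0) (hc : νf = c • Measure.map (torusFinSplit W (placesAbove (k := k) p)).symm (νS.prod νA))
    (νf' : Measure (torusFin' W)) [νf'.IsHaarMeasure]
    (νS' : Measure (torusFinAt' W (placesAbove (k := k) p))) [νS'.IsHaarMeasure]
    (νA' : Measure (torusFinAway' W (placesAbove (k := k) p))) [νA'.IsHaarMeasure]
    (c' : ℝ≥0) (hc' : νf' = c' • Measure.map (torusFinSplit' W (placesAbove (k := k) p)).symm (νS'.prod νA'))
    (DZS : Set (torusFinAt W (placesAbove (k := k) p))) (hDZS : MeasurableSet DZS)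
    (DZA : Set (torusFinAway W (placesAbove (k := k) p))) (hDZA : MeasurableSet DZA)
    (hint : IntegrableOn (fun b : torusFin W => R.chi (b : torusT W) * innerFin W R (levelDC W γ₀ (p ^ n)) γ₀ νf' b)
      ((torusFinSplit W (placesAbove (k := k) p)) ⁻¹' (DZS ×ˢ DZA)) νf)
    (hB : ∀ t : torusT W, Integrable (fun b' : torusFin' W => conj (R.chi' (b' : torusT' W)) *
      levelDC W γ₀ (p ^ n) ((GA.ofFinPart W t)⁻¹ * GA.ofFinPart W γ₀ * ((b' : torusT' W) : GA W))) νf') :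
    ∫ b in (torusFinSplit W (placesAbove (k := k) p)) ⁻¹' (DZS ×ˢ DZA),
        R.chi (b : torusT W) * innerFin W R (levelDC W γ₀ (p ^ n)) γ₀ νf' b ∂νf =
      ((c : ℂ) * (c' : ℂ)) * localFactorAt W (placesAbove (k := k) p) R γ₀ (p ^ n) νS νS' DZS *
        awayOrbital W (placesAbove (k := k) p) R γ₀ νA νA' DZA := by
  have hD : MeasurableSet ((torusFinSplit W (placesAbove (k := k) p)) ⁻¹' (DZS ×ˢ DZA)) :=
    measurableSet_preimage_torusFinSplit_prod W _ hDZS hDZA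
  rw [← integral_indicator hD, integral_eq_smul_integral_prod_fin W _ νf νS νA c hc _ (hint.integrable_indicator hD),
    Complex.real_smul]
  -- the integrand at `x y`
  have hpt : ∀ (x : torusFinAt W (placesAbove (k := k) p)) (y : torusFinAway W (placesAbove (k := k) p)),
      ((torusFinSplit W (placesAbove (k := k) p)) ⁻¹' (DZS ×ˢ DZA)).indicator
        (fun b : torusFin W => R.chi (b : torusT W) * innerFin W R (levelDC W γ₀ (p ^ n)) γ₀ νf' b)
        ((x : torusFin W) * (y : torusFin W)) =
      (c' : ℂ) *
        (DZS.indicator (fun x : torusFinAt W (placesAbove (k := k) p) => R.chi ((x : torusFin W) : torusT W) *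
          ∫ x', conj (R.chi' ((x' : torusFin' W) : torusT' W)) *
            levelDCAt W (placesAbove (k := k) p) γ₀ (p ^ n) ((((x : torusFin W) : torusT W) : GA W)⁻¹ *
              GA.ofFinPart W γ₀ * (((x' : torusFin' W) : torusT' W) : GA W)) ∂νS') x) *
        (DZA.indicator (fun y : torusFinAway W (placesAbove (k := k) p) => R.chi ((y : torusFin W) : torusT W) *
          ∫ y', conj (R.chi' ((y' : torusFin' W) : torusT' W)) *
            levelDCAway W (placesAbove (k := k) p) γ₀ 1 ((((y : torusFin W) : torusT W) : GA W)⁻¹ *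
              GA.ofFinPart W γ₀ * (((y' : torusFin' W) : torusT' W) : GA W)) ∂νA') y) := by
    intro x y
    have hmem : (x : torusFin W) * (y : torusFin W) ∈ (torusFinSplit W (placesAbove (k := k) p)) ⁻¹' (DZS ×ˢ DZA) ↔
        x ∈ DZS ∧ y ∈ DZA := by
      have h1 : (x : torusFin W) * (y : torusFin W) = (torusFinSplit W (placesAbove (k := k) p)).symm (x, y) :=
        (torusFinSplit_symm_apply W _ (x, y)).symm
      rw [Set.mem_preimage, h1, (torusFinSplit W _).apply_symm_apply, Set.mem_prod]
    by_cases hxy : x ∈ DZS ∧ y ∈ DZA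
    · rw [Set.indicator_of_mem (hmem.2 hxy), Set.indicator_of_mem hxy.1, Set.indicator_of_mem hxy.2, chi_coe_mul,
        innerFin_levelDC_coe_mul W _ R γ₀ (p ^ n) νf' νS' νA' c' hc' hB x y]
      simp_rw [levelDCAway_pow_eq]
      ring
    · rw [Set.indicator_of_notMem (fun h => hxy (hmem.1 h))]
      rcases not_and_or.1 hxy with hx | hy
      · rw [Set.indicator_of_notMem hx, mul_zero, zero_mul]
      · rw [Set.indicator_of_notMem hy, mul_zero]
  have hsep : ∫ x, ∫ y, ((torusFinSplit W (placesAbove (k := k) p)) ⁻¹' (DZS ×ˢ DZA)).indicator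
        (fun b : torusFin W => R.chi (b : torusT W) * innerFin W R (levelDC W γ₀ (p ^ n)) γ₀ νf' b)
        ((x : torusFin W) * (y : torusFin W)) ∂νA ∂νS =
      (c' : ℂ) * (∫ x, DZS.indicator (fun x : torusFinAt W (placesAbove (k := k) p) =>
          R.chi ((x : torusFin W) : torusT W) *
          ∫ x', conj (R.chi' ((x' : torusFin' W) : torusT' W)) *
            levelDCAt W (placesAbove (k := k) p) γ₀ (p ^ n) ((((x : torusFin W) : torusT W) : GA W)⁻¹ *
              GA.ofFinPart W γ₀ * (((x' : torusFin' W) : torusT' W) : GA W)) ∂νS') x ∂νS) *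
        (∫ y, DZA.indicator (fun y : torusFinAway W (placesAbove (k := k) p) =>
          R.chi ((y : torusFin W) : torusT W) *
          ∫ y', conj (R.chi' ((y' : torusFin' W) : torusT' W)) *
            levelDCAway W (placesAbove (k := k) p) γ₀ 1 ((((y : torusFin W) : torusT W) : GA W)⁻¹ *
              GA.ofFinPart W γ₀ * (((y' : torusFin' W) : torusT' W) : GA W)) ∂νA') y ∂νA) := by
    rw [mul_assoc, ← integral_mul_const, ← integral_const_mul]
    refine integral_congr_ae (Filter.Eventually.of_forall fun x => ?_)
    dsimp only
    rw [← mul_assoc, ← integral_const_mul]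
    refine integral_congr_ae (Filter.Eventually.of_forall fun y => ?_)
    dsimp only
    exact hpt x y
  rw [hsep, integral_indicator hDZS, integral_indicator hDZA]
  unfold localFactorAt awayOrbital
  ring

end Main

end Summit.Ventures.HodgeRepro.Tier4.Line4

end
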